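import Literature.Computability.Complexity.TimeConstructibleClosure
import HarnessLib

/-!
# Padded-body verifiers: an `FP` body on a `T`-padded input with a truncated witness places a
# language in `NTIME (T · ^ k)`, the exponent depending on the body only

Literature / complexity toolkit. The machine half of the derandomized simulation `N` of
Murray–Williams 2018, Lemma 4.1 (ECCC TR17-188 p. 14; `MurrayWilliams2018Simulation.lean`,
`MurrayWilliams2018Lemma41Assembly.lean`, hypothesis `hN` of
`MWSim.MurrayWilliams2018_lemma_4_1_ae_of_thm_3_1_of_thm_2_1_of_sim`) must put a language in
`NTIME (t · ^ E)` with an exponent `E` fixed BEFORE the referee, the verifier and the time bound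
are known (the exponent `e` of the lemma is chosen first, and the protocol of Thm. 3.1 depends on
`s(e·)`). The tree's idiom for nondeterministic machines at a superpolynomial time scale
(`IKWSimulationMachine.lean`: a clock writing a pad, the truncating wrapper `truncMapAux` cutting
the witness, and a polynomial-time BODY on the padded input) yields this if the body is ONE fixed
`FP` function receiving everything instance-specific — codes of machines, constants — as a data
prefix `D`: the running time is then `poly_B(T(n))` with the polynomial of the body, whatever `D`
and `T` are. This file proves that packaging once and for all:

* `PadVerif.dupLenProg` (`z ↦ ⟨z, 1^{|z|}⟩`), `PadVerif.prependProg D` (`z ↦ ⟨D, z⟩`) — linear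
  stack programs (`ACom`, `SymbolPrograms.lean`; the doubling stage is `UnaryClock.emit`);
* `PadVerif.exists_padClock` — for time-constructible `T`, the clock
  `w ↦ ⟨⟨w, 1^{T |w|}⟩, 1^{2|w| + T|w| + 2}⟩` in `O(T |w|)` steps
  (`exists_unaryClock_of_timeConstructible`, then `dupLenProg`);
* `PadVerif.lang B D T = {w | ∃ u, |u| ≤ 2|w| + T|w| + 2 ∧ B ⟨D, ⟨⟨w, 1^{T|w|}⟩, u⟩⟩ = [1]}`;
* **`PadVerif.exists_exponent`** — for `B ∈ FP` answering one bit on every input there is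
  `k ≥ 1` such that FOR ALL data `D` and ALL time-constructible `T`,
  `lang B D T ∈ NTIME (T · ^ k)`: the verifier `truncMapAux (padClock) ; prepend D ; M_B` runs in
  `O_D((T n)^k) + |u|/2` steps (`outputsWithin_truncMapAux_boolPair`,
  `Turing.TM2ComputableAux.comp_outputsWithin`), and its admissible witnesses certify `lang`
  (the body only sees `u ↾ (2|w| + T|w| + 2)`).

Theorems and program definitions only; no named fact.

## References

* S. Arora, B. Barak, *Computational Complexity: A Modern Approach*, CUP 2009, Def. 2.1 / Thm. 2.6
  (verifier form of `NTIME`), §1.3 (clocks, composition) [AroraBarakCC2009].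
* C. D. Murray, R. R. Williams, *Circuit lower bounds for nondeterministic quasi-polytime: an easy
  witness lemma for NP and NQP*, STOC 2018 (ECCC TR17-188), proof of Lemma 4.1, p. 14 (the
  simulation `N` "takes time `O(t(nᵢ)^{a+g})`") [MurrayWilliams2018].
-/

namespace Literature.Computability.Complexity

open _root_.Computability Turing Filter Polynomial

namespace PadVerif

open UnaryClock ACom

/-! ### Two linear stack programs -/

/-- `dupLen`: `z ↦ ⟨z, 1^{|z|}⟩` — count the input on `u` while reversing it onto `xr`, then
`UnaryClock.emit` (write `1^{|z|}`, the separator, the doubled payload). [folklore] -/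
def dupLenProg : Prog := (loop .inp fun b => push .xr b ;; push .u true) ;; emit

/-- Effect and cost of `dupLenProg`: `11 |z| + 5` steps. [folklore] -/
theorem runs_dupLenProg (z : List Bool) :
    Runs dupLenProg (AStore.single .inp z) (AStore.single .out (boolPair z (un z.length)))
      (11 * z.length + 5) := by
  rw [single_inp, single_out]
  unfold dupLenProg
  exact ((runs_pre_split z).seq (runs_emit z z.length)).of_eq rfl (by omega)

/-- **The machine of `dupLenProg`**: `z ↦ ⟨z, 1^{|z|}⟩` within `11 |z| + 6` steps. [folklore] -/
theorem exists_machine_dupLen : ∃ M : TM2ComputableAux Bool Bool, ∀ z : List Bool,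
    M.OutputsWithin z (boolPair z (un z.length)) (11 * z.length + 6) := by
  obtain ⟨M, hM⟩ := ACom.exists_computesInTime dupLenProg .inp .out
    (id : List Bool → List Bool) id (fun z => boolPair z (un z.length)) (fun z => 11 * z.length + 5)
    runs_dupLenProg
  exact ⟨M, fun z => hM z⟩

/-- `prepend D`: `z ↦ ⟨D, z⟩` — copy `z` to `out` (two pours), then push the constant prefix
`D D… 0 1` in front. [folklore] -/
def prependProg (D : List Bool) : Prog :=
  pour .inp .xr ;; pour .xr .out ;; pushList .out (((D.flatMap fun b => [b, b]) ++ [false, true]).reverse)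

/-- Effect and cost of `prependProg D`: `6 |z| + 2 |D| + 4` steps. [folklore] -/
theorem runs_prependProg (D z : List Bool) :
    Runs (prependProg D) (AStore.single .inp z) (AStore.single .out (boolPair D z))
      (6 * z.length + 2 * D.length + 4) := by
  rw [single_inp, single_out]
  unfold prependProg
  have h1 := runs_pour (Γ := Bool) (a := Rg.inp) (b := Rg.xr) (by decide) (mk z [] [] [] [] [])
  simp only [mk_inp, mk_xr, List.append_nil, update_mk_inp, update_mk_xr] at h1
  have h2 := runs_pour (Γ := Bool) (a := Rg.xr) (b := Rg.out) (by decide) (mk [] z.reverse [] [] [] [])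
  simp only [mk_xr, mk_out, List.reverse_reverse, List.append_nil, update_mk_xr, update_mk_out,
    List.length_reverse] at h2
  have h3 := runs_pushList (Γ := Bool) Rg.out (((D.flatMap fun b => [b, b]) ++ [false, true]).reverse)
    (mk [] [] [] [] [] z)
  -- doubling doubles the length (cf. `length_flatMap_dup`, `CircuitClassesProofs.lean`)
  have hdbl : ∀ x : List Bool, (x.flatMap fun b => [b, b]).length = 2 * x.length := by
    intro x
    induction x with
    | nil => rfl
    | cons b x ih =>
      simp only [List.flatMap_cons, List.length_append, ih, List.length_cons, List.length_nil]; omega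
  simp only [mk_out, update_mk_out, List.reverse_reverse, List.length_reverse, List.length_append,
    hdbl] at h3
  refine (h1.seq (h2.seq h3)).of_eq ?_ ?_
  · simp [boolPair]
  · simp only [List.length_cons, List.length_nil]; omega

/-- **The machine of `prependProg D`**: `z ↦ ⟨D, z⟩` within `6 |z| + 2 |D| + 5` steps. [folklore] -/
theorem exists_machine_prepend (D : List Bool) : ∃ M : TM2ComputableAux Bool Bool, ∀ z : List Bool,
    M.OutputsWithin z (boolPair D z) (6 * z.length + 2 * D.length + 5) := by
  obtain ⟨M, hM⟩ := ACom.exists_computesInTime (prependProg D) .inp .out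
    (id : List Bool → List Bool) id (fun z => boolPair D z) (fun z => 6 * z.length + 2 * D.length + 4)
    (runs_prependProg D)
  exact ⟨M, fun z => hM z⟩

/-! ### The padded clock -/

/-- **The padded clock** of a time-constructible `T`: `w ↦ ⟨⟨w, 1^{T |w|}⟩, 1^{2|w| + T|w| + 2}⟩`
within `a · T|w| + a` steps (the unary clock `w ↦ ⟨w, 1^{T|w|}⟩`, then `dupLenProg`; `|w| ≤ T |w|`).
[cite: AroraBarakCC2009, §1.3] -/
theorem exists_padClock {T : ℕ → ℕ} (hT : IsTimeConstructible T) :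
    ∃ (M : TM2ComputableAux Bool Bool) (a : ℕ), ∀ w : List Bool,
      M.OutputsWithin w (boolPair (boolPair w (un (T w.length))) (un (2 * w.length + T w.length + 2)))
        (a * T w.length + a) := by
  have hge := hT.1
  obtain ⟨N, a, hN⟩ := exists_unaryClock_of_timeConstructible hT
  obtain ⟨Md, hMd⟩ := exists_machine_dupLen
  refine ⟨N.comp Md, a + 33 + 27, fun w => ?_⟩
  have h1 := hN w
  have h2 := hMd (boolPair w (un (T w.length)))
  have hl : (boolPair w (un (T w.length))).length = 2 * w.length + T w.length + 2 := by
    simp only [length_boolPair, un, List.length_replicate]; omega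
  rw [hl] at h2
  have h := TM2ComputableAux.comp_outputsWithin _ _ h1 h2
  refine h.mono ?_
  have := hge w.length
  nlinarith

/-! ### The padded-body language and its verifier -/

/-- **The padded-body language** of a body `B`, data `D` and pad `T`: the words `w` having a
witness `u` of length `≤ 2|w| + T|w| + 2` with `B ⟨D, ⟨⟨w, 1^{T|w|}⟩, u⟩⟩ = [1]`. [folklore] -/
def lang (B : List Bool → List Bool) (D : List Bool) (T : ℕ → ℕ) : Language Bool :=
  {w | ∃ u : List Bool, u.length ≤ 2 * w.length + T w.length + 2 ∧
    B (boolPair D (boolPair (boolPair w (un (T w.length))) u)) = [true]}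

/-- Unfolding of `lang`. [folklore] -/
theorem mem_lang_iff {B : List Bool → List Bool} {D : List Bool} {T : ℕ → ℕ} {w : List Bool} :
    w ∈ lang B D T ↔ ∃ u : List Bool, u.length ≤ 2 * w.length + T w.length + 2 ∧
      B (boolPair D (boolPair (boolPair w (un (T w.length))) u)) = [true] :=
  Iff.rfl

/-- Polynomials in a padded length are polynomial in the pad: `c (x + b)^k + c ≤ C x^k + C`
with `C = c (b + 1)^k + c` — for `x ≥ 1`, `x + b ≤ (b + 1) x`. [folklore] -/
theorem mul_add_pow_le (c b k : ℕ) : ∃ C : ℕ, ∀ x : ℕ, c * (x + b) ^ k + c ≤ C * x ^ k + C := by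
  refine ⟨c * (b + 1) ^ k + c, fun x => ?_⟩
  rcases Nat.eq_zero_or_pos x with rfl | hx
  · have h1 : c * (0 + b) ^ k ≤ c * (b + 1) ^ k :=
      Nat.mul_le_mul_left c (Nat.pow_le_pow_left (by omega) k)
    calc c * (0 + b) ^ k + c ≤ c * (b + 1) ^ k + c := Nat.add_le_add_right h1 _
      _ ≤ (c * (b + 1) ^ k + c) * 0 ^ k + (c * (b + 1) ^ k + c) := Nat.le_add_left _ _
  · have h1 : x + b ≤ (b + 1) * x := by nlinarith
    have h2 : (x + b) ^ k ≤ (b + 1) ^ k * x ^ k := by rw [← mul_pow]; exact Nat.pow_le_pow_left h1 _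
    have h3 : c * (x + b) ^ k ≤ c * (b + 1) ^ k * x ^ k := by
      rw [Nat.mul_assoc]; exact Nat.mul_le_mul_left _ h2
    have h4 : c * (b + 1) ^ k * x ^ k ≤ (c * (b + 1) ^ k + c) * x ^ k :=
      Nat.mul_le_mul_right _ (Nat.le_add_right _ _)
    calc c * (x + b) ^ k + c ≤ (c * (b + 1) ^ k + c) * x ^ k + c := Nat.add_le_add_right (h3.trans h4) _
      _ ≤ (c * (b + 1) ^ k + c) * x ^ k + (c * (b + 1) ^ k + c) :=
          Nat.add_le_add_left (Nat.le_add_left _ _) _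

/-- **The exponent of a body, dominated form.** For `B ∈ FP` answering one bit on every input
there is `k ≥ 1` such that for ALL data `D`, ALL time-constructible `T` and every bound `g` with
`(T n)^k ≤ C g(n) + C` for all `n`, `lang B D T ∈ NTIME g`: the
verifier `truncMapAux (padClock_T) ; prepend D ; M_B` outputs the body's bit on
`⟨D, ⟨⟨w, 1^{T|w|}⟩, u ↾ (2|w| + T|w| + 2)⟩⟩` within `O_D((T|w|)^k) + |u|/2` steps, and its
admissible witnesses certify membership in `lang` (prefixes of witnesses are witnesses). The
exponent `k` is read off the polynomial of `M_B` alone. [cite: AroraBarakCC2009, Def. 2.1 / Thm. 2.6; §1.3] -/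
theorem exists_exponent_dom {B : List Bool → List Bool} (hB : B ∈ FP) (hB1 : ∀ z, ∃ b : Bool, B z = [b]) :
    ∃ k : ℕ, 1 ≤ k ∧ ∀ (D : List Bool) (T : ℕ → ℕ), IsTimeConstructible T → ∀ (g : ℕ → ℕ) (Cg : ℕ),
      (∀ n, T n ^ k ≤ Cg * g n + Cg) → lang B D T ∈ NTIME g := by
  obtain ⟨p, MB, hMB⟩ := hB
  obtain ⟨c₁, k, hk⟩ := exists_eval_le_mul_pow_add p
  refine ⟨k + 1, by omega, fun D T hT g Cg hg => ?_⟩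
  have hge := hT.1
  obtain ⟨Mc, a, hMc⟩ := exists_padClock hT
  obtain ⟨Mp, hMp⟩ := exists_machine_prepend D
  -- the constant of the time bound: everything but `|u|/2` is `≤ C₀ (T n)^(k+1) + C₀`
  obtain ⟨C₁, hC₁⟩ := mul_add_pow_le c₁ (2 * D.length + 12) k
  set G : ℕ := C₁ * 9 ^ k with hG
  set C₀ : ℕ := 2 * a + 145 + 2 * D.length + G + C₁ + 3 with hC₀
  -- the verifier and the relation
  let Vm : TM2ComputableAux Bool Bool := (truncMapAux Mc).comp (Mp.comp MB)
  let U : List Bool → ℕ := fun w => 2 * w.length + T w.length + 2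
  let R : List Bool → List Bool → Bool := fun w u =>
    decide (B (boolPair D (boolPair (boolPair w (un (T w.length))) (u.take (U w)))) = [true])
  set C₂ : ℕ := C₀ * Cg + C₀ with hC₂
  refine ⟨2 * C₂ + 2, R, Vm, fun w u hu => ?_, fun w => ?_⟩
  · -- running time
    have hTn : w.length ≤ T w.length := hge _
    -- stage 1: the clock under the truncating wrapper
    have h1 := outputsWithin_truncMapAux_boolPair Mc (x := w) (y := u) (hMc w)
    have hl1 : (un (2 * w.length + T w.length + 2)).length = U w := by
      simp only [un, List.length_replicate]; rfl
    rw [hl1] at h1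
    -- stage 2: prepend the data
    have h2 := hMp (boolPair (boolPair w (un (T w.length))) (u.take (U w)))
    -- stage 3: the body
    obtain ⟨b, hb⟩ := hB1 (boolPair D (boolPair (boolPair w (un (T w.length))) (u.take (U w))))
    have h3 := hMB (boolPair D (boolPair (boolPair w (un (T w.length))) (u.take (U w))))
    have h23 := TM2ComputableAux.comp_outputsWithin _ _ h2 h3
    have h := TM2ComputableAux.comp_outputsWithin _ _ h1 h23
    have hout : B (boolPair D (boolPair (boolPair w (un (T w.length))) (u.take (U w)))) =
        encodeBool (R w u) := by
      simp only [R, hb]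
      cases b <;> rfl
    rw [hout] at h
    dsimp only [id] at h
    refine h.mono ?_
    -- lengths
    have hU : U w = 2 * w.length + T w.length + 2 := rfl
    have hlw : (boolPair w (un (T w.length))).length = 2 * w.length + T w.length + 2 := by
      simp only [length_boolPair, un, List.length_replicate]; omega
    have hl2 : (boolPair (boolPair w (un (T w.length))) (u.take (U w))).length ≤
        3 * (2 * w.length + T w.length + 2) + 2 := by
      have := List.length_take_le (U w) u
      simp only [length_boolPair] at hlw ⊢; omega
    have hl3 : (boolPair D (boolPair (boolPair w (un (T w.length))) (u.take (U w)))).length ≤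
        9 * T w.length + (2 * D.length + 12) := by
      have : (boolPair D (boolPair (boolPair w (un (T w.length))) (u.take (U w)))).length =
          2 * D.length + (boolPair (boolPair w (un (T w.length))) (u.take (U w))).length + 2 := by
        simp only [length_boolPair]; omega
      omega
    have hp : p.eval (boolPair D (boolPair (boolPair w (un (T w.length))) (u.take (U w)))).length ≤
        C₁ * (9 * T w.length) ^ k + C₁ :=
      (TM2Iter.eval_mono p hl3).trans ((hk _).trans (hC₁ _))
    -- the nonlinear atoms, bounded linearly in `X = (T |w|)^(k+1)`
    have hT1 : T w.length ≤ T w.length ^ (k + 1) + 1 := by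
      rcases Nat.eq_zero_or_pos (T w.length) with h0 | hpos
      · rw [h0]; exact Nat.zero_le _
      · calc T w.length = T w.length ^ 1 := (pow_one _).symm
          _ ≤ T w.length ^ (k + 1) := Nat.pow_le_pow_right hpos (by omega)
          _ ≤ T w.length ^ (k + 1) + 1 := Nat.le_succ _
    have hQ : C₁ * (9 * T w.length) ^ k ≤ G * T w.length ^ (k + 1) + G := by
      have h9 : (9 * T w.length) ^ k ≤ 9 ^ k * T w.length ^ (k + 1) + 9 ^ k := by
        rw [mul_pow]
        rcases Nat.eq_zero_or_pos (T w.length) with h0 | hpos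
        · rw [h0]
          rcases Nat.eq_zero_or_pos k with rfl | hk0
          · simp
          · simp [Nat.zero_pow hk0]
        · have : T w.length ^ k ≤ T w.length ^ (k + 1) := Nat.pow_le_pow_right hpos (Nat.le_succ k)
          exact (Nat.mul_le_mul_left _ this).trans (Nat.le_add_right _ _)
      calc C₁ * (9 * T w.length) ^ k ≤ C₁ * (9 ^ k * T w.length ^ (k + 1) + 9 ^ k) :=
            Nat.mul_le_mul_left _ h9
        _ = G * T w.length ^ (k + 1) + G := by simp only [hG]; ring
    have haT : a * T w.length ≤ a * T w.length ^ (k + 1) + a := by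
      calc a * T w.length ≤ a * (T w.length ^ (k + 1) + 1) := Nat.mul_le_mul_left _ hT1
        _ = a * T w.length ^ (k + 1) + a := by ring
    have hu2 : u.length ≤ (2 * C₂ + 2) * g w.length + (2 * C₂ + 2) := hu
    -- first: everything but `|u|/2` is `≤ C₀ X + C₀`, `X = (T|w|)^(k+1) ≤ Cg g + Cg`
    have hX : T w.length ^ (k + 1) ≤ Cg * g w.length + Cg := hg _
    suffices hmain : p.eval (boolPair D (boolPair (boolPair w (un (T w.length))) (u.take (U w)))).length +
        (6 * (boolPair (boolPair w (un (T w.length))) (u.take (U w))).length + 2 * D.length + 5) +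
        (a * T w.length + a + 3 * (boolPair w (un (T w.length))).length + 2 * U w + 2 * w.length + 11) ≤
        C₀ * T w.length ^ (k + 1) + C₀ by
      have h1 : C₀ * T w.length ^ (k + 1) + C₀ ≤ C₂ * g w.length + C₂ := by
        calc C₀ * T w.length ^ (k + 1) + C₀ ≤ C₀ * (Cg * g w.length + Cg) + C₀ :=
              Nat.add_le_add_right (Nat.mul_le_mul_left _ hX) _
          _ = (C₀ * Cg) * g w.length + (C₀ * Cg + C₀) := by ring
          _ ≤ C₂ * g w.length + C₂ := by
              simp only [hC₂]
              exact Nat.add_le_add_right (Nat.mul_le_mul_right _ (Nat.le_add_right _ _)) _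
      have e2 : (2 * C₂ + 2) * g w.length = 2 * (C₂ * g w.length) + 2 * g w.length := by ring
      rw [e2] at hu2 ⊢
      generalize C₂ * g w.length = Y at hu2 h1 ⊢
      omega
    -- expand the constant and conclude linearly
    have eC : C₀ * T w.length ^ (k + 1) = 2 * (a * T w.length ^ (k + 1)) + 145 * T w.length ^ (k + 1) +
        2 * (D.length * T w.length ^ (k + 1)) + G * T w.length ^ (k + 1) + C₁ * T w.length ^ (k + 1) +
        3 * T w.length ^ (k + 1) := by
      simp only [hC₀]; ring
    have eC0 : C₀ = 2 * a + 145 + 2 * D.length + G + C₁ + 3 := hC₀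
    rw [eC]
    rw [hlw, hU]
    rw [eC0]
    clear hu2
    generalize T w.length ^ (k + 1) = X at hQ haT hT1 ⊢
    generalize p.eval (boolPair D (boolPair (boolPair w (un (T w.length))) (u.take (U w)))).length = Pv at hp ⊢
    generalize C₁ * (9 * T w.length) ^ k = Q at hp hQ
    generalize a * T w.length = aT at haT ⊢
    generalize a * X = aX at haT ⊢
    generalize D.length * X = dX at ⊢
    generalize G * X = GX at hQ ⊢
    generalize C₁ * X = cX at ⊢
    generalize (boolPair (boolPair w (un (T w.length))) (u.take (U w))).length = len₂ at hl2 ⊢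
    generalize T w.length = Tn at hTn hT1 hl2 ⊢
    generalize w.length = n at hTn hl2 ⊢
    clear_value G C₀ C₂
    omega
  · -- the admissible witnesses certify `lang`
    constructor
    · rintro ⟨u, hu, hB⟩
      refine ⟨u, ?_, ?_⟩
      · have h1 : 2 * w.length + T w.length + 2 ≤ 3 * T w.length + 2 := by
          have := hge w.length; omega
        have h2 : T w.length ≤ T w.length ^ (k + 1) := by
          rcases Nat.eq_zero_or_pos (T w.length) with h0 | hpos
          · rw [h0]; exact Nat.zero_le _
          · calc T w.length = T w.length ^ 1 := (pow_one _).symm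
              _ ≤ T w.length ^ (k + 1) := Nat.pow_le_pow_right hpos (by omega)
        have h3 : 3 ≤ C₀ := by simp only [hC₀]; omega
        have h4 : 3 * Cg ≤ C₂ := by
          simp only [hC₂]; nlinarith
        have hX : T w.length ^ (k + 1) ≤ Cg * g w.length + Cg := hg _
        nlinarith
      · simp only [R, decide_eq_true_eq]
        rw [List.take_of_length_le hu]
        exact hB
    · rintro ⟨u, -, hR⟩
      simp only [R, decide_eq_true_eq] at hR
      exact ⟨u.take (U w), List.length_take_le _ _, hR⟩

/-- **The exponent of a body.** For `B ∈ FP` answering one bit on every input there is `k ≥ 1`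
such that for ALL data `D` and ALL time-constructible `T`, `lang B D T ∈ NTIME (T · ^ k)`
(`exists_exponent_dom` with `g = T^k`, `C = 1`). The exponent `k` is read off the polynomial of
`M_B` alone. [cite: AroraBarakCC2009, Def. 2.1 / Thm. 2.6; §1.3] -/
theorem exists_exponent {B : List Bool → List Bool} (hB : B ∈ FP) (hB1 : ∀ z, ∃ b : Bool, B z = [b]) :
    ∃ k : ℕ, 1 ≤ k ∧ ∀ (D : List Bool) (T : ℕ → ℕ), IsTimeConstructible T →
      lang B D T ∈ NTIME fun n => T n ^ k := by
  obtain ⟨k, hk, h⟩ := exists_exponent_dom hB hB1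
  exact ⟨k, hk, fun D T hT => h D T hT (fun n => T n ^ k) 1 fun n => by omega⟩

end PadVerif

end Literature.Computability.Complexity
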